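import Summits.Schanuel.Schanuel.Theorems.RootDecomp1BFactDischarge01
import Literature.NumberTheory.Transcendental.ExpOneTranscendenceMeasureProofs

/-!
# RootDecomp1BMovingZeroFree — lens 4, generation 42 «LEVEL-e SLOT BY PROOF» (RULE E-R21 (c) + B-R26 (a″); VERDICT L2187: THEOREM ×1 (B-g42)): the (1 | ρ) moving-zero storey HYPOTHESIS-FREE and one exponential order lower — `∀ ρ, LiouvilleOrder 7 ρ → 4 ≤ polarDeg (1, ρ)` and every (1|ρ) cell / member / 1K-link instance of FactDischarge01 + MovingZero02 §4 UNCONDITIONAL (record: order 8 mod hX) — the slot `ExpOneAlgApprox C` (an approximation measure for e with the degree binder n ≤ Y) filled BY PROOF from the Literature theorem NW96 Thm 4 (2), new separating member T₈ = towerNumber 8 — part 1 (RootDecomp1BMovingZeroFree01): §1 slot + suppliers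

(lens-4 g42 HOME kernel MovingZeroFree.lean 1a475554…, 622 l, imports tree RootDecomp1BFactDischarge01 + Literature ExpOneTranscendenceMeasureProofs; CLAIM L2168, ACK/RULING/CHECKLIST B-g42 L2169, NODE L2183 / REQUEST L2184 / RESULT L2185, writer re-check L2186, critic VERDICT L2187 (CLEARED — THEOREM ×1 (B-g42); RULE B-R28; PORT GO 01–05 along K's § boundaries, `--supports stmt-Schanuel-24622`); port by census-1 gen 18 as `RootDecomp1BMovingZeroFree01`–`05`: 01 = §1 the slot `ExpOneAlgApprox` + its two suppliers (record hX, and BY PROOF from NW96 Thm 4(2)); 02 = §2 the budget and the engine one order lower (slot + `LiouvilleOrder 7` + moving zero ⟹ t ≥ 4); 03 = §3 the cells HYPOTHESIS-FREE; 04 = §4 members binder-free + the separating member `T₈ = towerNumber 8`; 05 = §5 the record recovered as an instance.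
PORT EDITS: the slot def's docstring tagged «[slot] definition with parameter; suppliers …» per the verdict (census convention); no `set_option` in K; three tree-twin helpers made `private` after the dedup bounce of 01 (p830609: `irreducible_map_rat_of_irreducible` ≡ Literature NW1996, `nesterenkoWaldschmidt1996_thm_4_2_inScope` ≡ `NesterenkoWaldschmidt1996_thm_4_2_holds`, `one_lt_log_sixteen` ≡ Literature Waldschmidt1978) with per-part private copies; statements and proofs verbatim. `--supports stmt-Schanuel-24622`; no census credit carried; rung 0 — nothing here proves Schanuel.)
-/

/-!
# RootDecomp1BMovingZeroFree — lens 4, generation 42 «LEVEL-e SLOT BY PROOF»: the (1 | ρ) moving-zero storey HYPOTHESIS-FREE, and one exponential order lower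

RULE E-R21 (c) (crit L2158) «hX-elimination needing NEW kernel work» on the 1B moving-zero class of
record (tree `RootDecomp1BFactDischarge01`: `four_le_polarDeg_one_of_liouvilleOrder_eight (hX)`,
`…_swap_… (hX)`, `…_one_hyper (hX)`, `…_one_rhoT (hX)`; `RootDecomp1BMovingZero02` §4), read with
VERDICT L2111 (B-R26 (a″)) as «discharge BY PROOF of the input the cell CONSUMES».  CLAIM L2168.

## The observation

In the endgame of record `RootDecomp1BMovingZero.four_le_polarDeg_of_movingZero` (MovingZero02
l.64–173) the support hypothesis `hX : ExplicitRatExpApprox` (KHyper06 l.75: Waldschmidt 1978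
Thm 3.8-shape approximation measure for `e^r`, every `r ∈ ℚ∖{0}`, degree-QUADRATIC exponent
`C₀(r)·n²·Y·(log Y + log n)²/log²Y`) is consumed ONCE, at `r = 1` (l.127), on a moving zero `ξ`
(root of an irreducible `Q ∈ ℤ[X]`) whose degree `n ≤ c₁ q²` is BELOW the height parameter
`Y ≍ q² log q ≥ log M(Q)` (l.118–121 prove `n ≤ Y`).  In that regime a degree-CUBIC measure is as
good as a degree-quadratic one: `n²(n + Y) ≤ 2 n² Y`.  And a degree-cubic APPROXIMATION MEASURE
FOR `e` IS PROVED IN THE TREE: `Literature.NumberTheory.Transcendental.NW1996.approx_measure_exp_one`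
(`ExpOneTranscendenceMeasureProofs.lean` l.82, the Mahler-measure form of [NesterenkoWaldschmidt1996,
Theorem 4 (1)], assembled there into `NesterenkoWaldschmidt1996_thm_4_2_holds`; 0 sorry):
`Irreducible (Q.map ℤ→ℚ) → aeval ξ Q = 0 → 1 ≤ ℓ → log M(Q) ≤ ℓ → exp(−63021·n²·(n + ℓ)) ≤ ‖e − ξ‖`.

So the cell's input is discharged BY PROOF — not `ExplicitRatExpApprox` literally (RULE E-R21 (f):
type 3 of `e` does not give the degree-quadratic statement; not claimed), but the SLOT the endgame
actually fills with it.

## Contents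

* §1 THE SLOT `ExpOneAlgApprox C` (the `r = 1` slice of `hX` with the extra binder `n ≤ Y` and the
  exponent `C·n²·Y`) and its two suppliers: (i) `expOneAlgApprox_of_shape` / `…_of_explicitRatExpApprox :
  ExplicitRatExpApprox → ExpOneAlgApprox (4 · C₀rat 1)` (tree `factor_le`) — the record is an INSTANCE;
  (ii) BY PROOF `expOneAlgApprox_holds : ExpOneAlgApprox 126042` from `NW1996.approx_measure_exp_one`
  through Gauss's lemma (`Irreducible.isPrimitive`, `IsPrimitive.Int.irreducible_iff_irreducible_map_cast`).
* §2 THE ENGINE RE-RUN ONE ORDER LOWER `four_le_polarDeg_of_slot (hLW) (hCₑ : 0 ≤ Cₑ) (hE : ExpOneAlgApprox Cₑ)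
  (hρ : LiouvilleOrder 7 ρ) (hMZ : MovingZeroApprox ρ) … : t(r) ≥ 4`: with the slot's exponent `Cₑ n² Y`
  and `Y := (c₁′ + c₂′) q² log(q+1)` (the record's `log(q+1) ≤ q` slack removed) the budget is
  `K q⁶ log(q+1)`, `K = Cₑ c₁′² (c₁′ + c₂′)`, against `κ q⁷` — the NAMED BUDGET `budget_lt :
  K q⁶ log(q+1) + L q⁶ < κ q⁷` beyond the explicit `q₀ = 2(K log T + κ + L)/κ`, `T = 2K/κ + 1` (the sub-linear
  logarithm by the T-trick lemma `log_le_log_add_div_sub_one`).  ORDER 7 (record: 8).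
* §3 THE CELLS, HYPOTHESIS-FREE (`lwMeasure_holds`, `movingZeroApprox_holds` of FactDischarge01 +
  `expOneAlgApprox_holds`): `four_le_polarDeg_of_liouvilleOrder_seven` (general polar field),
  `four_le_polarDeg_one_of_liouvilleOrder_seven : LiouvilleOrder 7 ρ → t(1, ρ) ≥ 4`, swap, hyper, every
  order `≥ 7`, the record names at order 8 WITHOUT `hX`, the `KleinPolarSchanuel` body at `m = 2`,
  `r = (1, ρ)` verbatim, `t ≥ 3`, the four At-steps of items 32406–08, the 1K live-link instances
  (items 33363 / 33364) — no fact binder anywhere.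
* §4 MEMBERS, binder-free: `ρ_T = towerNumber 9`, `λ_H`, and the NEW SEPARATING MEMBER `T₈ = towerNumber 8`
  (order 7 by the tree; NOT of order 8 by the new lemma `not_liouvilleOrder_self_towerNumber :
  2 ≤ c → ¬ LiouvilleOrder c (towerNumber c)`, whose `1 − log 2` margin is the named lemma
  `two_mul_two_pow_le_exp_pow : 2q·2^{q^c} ≤ e^{q^c}` (`q ≥ 7`); not hyper-, not ultra-Liouville) — OUTSIDE the
  class of record.
* §5 RECORD RECOVERED as the instance `Cₑ = 4 · C₀rat 1` of the engine (one order lower, still mod `hX`).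

Inputs of the storey after this file: ∅ (was {`ExplicitRatExpApprox`}).  No new fact, no new binder,
no `sorry`; every cell's `#print axioms` is `[propext, Classical.choice, Quot.sound]` (probe file).
Items 32406–08 / 24622 stay OPEN (these are At-cells / the body at ONE tuple); rung 0 — nothing here
proves Schanuel.
-/

noncomputable section

open Complex Polynomial

namespace Summit.Schanuel.Schanuel.Theorems.RootDecomp1BMovingZeroFree

open Summit.Schanuel.Schanuel.Theorems.RootDecomp1KHyper (LWMeasure)
open Summit.Schanuel.Schanuel.Theorems.RootDecomp1KHyper.HyperCell (log_sixteen_lt_three HyperLiouville lambdaH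
  hyperLiouville_lambdaH ExplicitRatExpApprox C₀rat)
open Summit.Schanuel.Schanuel.Theorems.RootDecomp1KGeneric (LiouvilleOrder)
open Summit.Schanuel.Schanuel.Theorems.RootDecomp1KFiniteOrderCell (towerNumber liouvilleOrder_towerNumber
  not_hyperLiouville_towerNumber towerNumber_sub_rat_lower liouville_towerNumber not_liouvilleOrder_towerNumber)
open Summit.Schanuel.Schanuel.Theorems.RootDecomp1BFedFlagCore (polarDeg polarField)
open Summit.Schanuel.Schanuel.Theorems.RootDecomp1BDefectFloorDefs (SharpRelativeLindemannAt TameDefectZeroAt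
  WildSharpDefectZeroAt WildSharpDefectZeroInitAt)
open Summit.Schanuel.Schanuel.Theorems.RootDecomp1BRadicalDescent (UltraLiouville linearIndependent_one_of_irrational)
open Summit.Schanuel.Schanuel.Theorems.RootDecomp1BMovingZero (triple MovingZeroApprox algebraicIndependent_triple
  isAlgebraic_pair_of_lt_four mem_polarField_one mem_polarField_swap factor_le four_le_polarDeg_of_movingZero
  liouvilleOrder_rhoT not_hyperLiouville_rhoT not_ultraLiouville_rhoT)
open Summit.Schanuel.Schanuel.Theorems.RootDecomp1BFactDischarge (lwMeasure_holds movingZeroApprox_holds)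
open Literature.NumberTheory.Transcendental (NesterenkoWaldschmidt1996_thm_4_2 NesterenkoWaldschmidt1996_thm_4_2_holds)
open Literature.NumberTheory.Transcendental.NW1996 (approx_measure_exp_one)

/-! ## §1  The slot and its two suppliers -/

/-- [slot] definition with parameter; suppliers: the record hypothesis `ExplicitRatExpApprox` (tree Hyper06) and, BY PROOF, the Literature theorem NW96 Thm 4 (2) `NesterenkoWaldschmidt1996_thm_4_2_holds` (§1 below).  **THE SLOT (level `e`) — a DEFINITION with a parameter, NOT a fact (no cite tag; it is FILLED below,
by the record's hypothesis AND by proof).**  An approximation measure for `e = exp 1` by algebraic numbers,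
in the shape the moving-zero endgame consumes: for `ξ` a root of an irreducible `Q ∈ ℤ[X]` of degree `n ≥ 1`
and every `Y ≥ max(log 16, n, log M(Q))`, `‖e − ξ‖ ≥ exp(−C · n² · Y)`.  The binder `n ≤ Y` (absent from
`ExplicitRatExpApprox`) is what lets a degree-cubic measure fill it. -/
def ExpOneAlgApprox (C : ℝ) : Prop :=
  ∀ Q : ℤ[X], Irreducible Q → 0 < Q.natDegree → ∀ ξ : ℂ, aeval ξ Q = 0 →
    ∀ Y : ℝ, Real.log 16 ≤ Y → (Q.natDegree : ℝ) ≤ Y → Real.log (Q.map (Int.castRingHom ℂ)).mahlerMeasure ≤ Y →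
      Real.exp (-(C * (Q.natDegree : ℝ) ^ 2 * Y)) ≤ ‖cexp 1 - ξ‖

/-- `1 < log 16` (`e < 2.72 < 16`). -/
private theorem one_lt_log_sixteen : 1 < Real.log 16 := by
  rw [Real.lt_log_iff_exp_lt (by norm_num)]
  have h1 := Real.exp_one_lt_d9
  linarith

/-- The tree constant `C₀rat r` is non-negative (re-proved: the tree's copy is private). -/
theorem C₀rat_nonneg (r : ℚ) : 0 ≤ C₀rat r := by
  unfold C₀rat; positivity

/-- The slot is monotone in its constant. -/
theorem ExpOneAlgApprox.mono {C C' : ℝ} (h : ExpOneAlgApprox C) (hCC' : C ≤ C') : ExpOneAlgApprox C' := by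
  intro Q hQ hd ξ hξ Y hY16 hnY hMY
  refine le_trans ?_ (h Q hQ hd ξ hξ Y hY16 hnY hMY)
  rw [Real.exp_le_exp, neg_le_neg_iff]
  have hY0 : 0 ≤ Y := le_trans (by linarith [one_lt_log_sixteen]) hY16
  have : 0 ≤ (Q.natDegree : ℝ) ^ 2 * Y := by positivity
  nlinarith

/-- **SUPPLIER (i), general form.**  Any approximation measure for `e` of the Waldschmidt-1978-Thm-3.8
shape (the shape of `ExplicitRatExpApprox` at `r = 1`, and of the tree's existential
`Waldschmidt1978.approx_measure_exp_alg` at `β = 1`) with constant `C₀ ≥ 0` fills the slot with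
`C = 4 C₀` — by the tree's exponent bookkeeping `factor_le` (`n ≤ Y`). -/
theorem expOneAlgApprox_of_shape {C₀ : ℝ} (hC₀ : 0 ≤ C₀)
    (h : ∀ Q : ℤ[X], Irreducible Q → 0 < Q.natDegree → ∀ ξ : ℂ, aeval ξ Q = 0 →
      ∀ Y : ℝ, Real.log 16 ≤ Y → Real.log (Q.map (Int.castRingHom ℂ)).mahlerMeasure ≤ Y →
        Real.exp (-(C₀ * (Q.natDegree : ℝ) ^ 2 * Y *
          (Real.log Y + Real.log Q.natDegree) ^ 2 / Real.log Y ^ 2)) ≤ ‖cexp 1 - ξ‖) :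
    ExpOneAlgApprox (4 * C₀) := by
  intro Q hQ hd ξ hξ Y hY16 hnY hMY
  refine le_trans ?_ (h Q hQ hd ξ hξ Y hY16 hMY)
  rw [Real.exp_le_exp, neg_le_neg_iff]
  have hf := mul_le_mul_of_nonneg_left (factor_le hd hnY hY16) hC₀
  calc C₀ * (Q.natDegree : ℝ) ^ 2 * Y * (Real.log Y + Real.log Q.natDegree) ^ 2 / Real.log Y ^ 2
      = C₀ * ((Q.natDegree : ℝ) ^ 2 * Y * (Real.log Y + Real.log Q.natDegree) ^ 2 / Real.log Y ^ 2) := by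
        ring
    _ ≤ C₀ * (4 * ((Q.natDegree : ℝ) ^ 2 * Y)) := hf
    _ = 4 * C₀ * (Q.natDegree : ℝ) ^ 2 * Y := by ring

/-- **SUPPLIER (i): the record's hypothesis fills the slot** (`r = 1`, `C = 4 · C₀rat 1`). -/
theorem expOneAlgApprox_of_explicitRatExpApprox (hX : ExplicitRatExpApprox) : ExpOneAlgApprox (4 * C₀rat 1) :=
  expOneAlgApprox_of_shape (C₀rat_nonneg 1) fun Q hQ hd ξ hξ Y hY16 hMY => by
    simpa only [Rat.cast_one] using hX 1 one_ne_zero Q hQ hd ξ hξ Y hY16 hMY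

/-- Gauss: an irreducible integer polynomial of positive degree is irreducible over `ℚ`. -/
private theorem irreducible_map_rat_of_irreducible {Q : ℤ[X]} (hQ : Irreducible Q) (hd : 0 < Q.natDegree) :
    Irreducible (Q.map (Int.castRingHom ℚ)) :=
  (IsPrimitive.Int.irreducible_iff_irreducible_map_cast (hQ.isPrimitive (Nat.pos_iff_ne_zero.mp hd))).mp hQ

/-- **SUPPLIER (ii): THE SLOT HOLDS, BY PROOF** — from the tree's PROVED approximation measure for `e`
`NW1996.approx_measure_exp_one` ([NesterenkoWaldschmidt1996, Theorem 4 (1)] in Mahler-measure form,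
`exp(−63021·n²·(n + ℓ)) ≤ ‖e − ξ‖`), with `ℓ = Y ≥ n`: `63021·n²·(n + Y) ≤ 126042·n²·Y`. -/
theorem expOneAlgApprox_holds : ExpOneAlgApprox 126042 := by
  intro Q hQ hd ξ hξ Y hY16 hnY hMY
  have hY1 : 1 ≤ Y := le_trans one_lt_log_sixteen.le hY16
  have h := approx_measure_exp_one (irreducible_map_rat_of_irreducible hQ hd) hξ hY1 hMY
  refine le_trans ?_ h
  rw [Real.exp_le_exp, neg_le_neg_iff]
  have hsum : (Q.natDegree : ℝ) + Y ≤ 2 * Y := by linarith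
  have hn2 : 0 ≤ 63021 * (Q.natDegree : ℝ) ^ 2 := by positivity
  calc 63021 * (Q.natDegree : ℝ) ^ 2 * (Q.natDegree + Y)
      ≤ 63021 * (Q.natDegree : ℝ) ^ 2 * (2 * Y) := mul_le_mul_of_nonneg_left hsum hn2
    _ = 126042 * (Q.natDegree : ℝ) ^ 2 * Y := by ring

/-- The slot is also filled with every larger constant (for quoting round numbers). -/
theorem expOneAlgApprox_of_le {C : ℝ} (hC : 126042 ≤ C) : ExpOneAlgApprox C :=
  expOneAlgApprox_holds.mono hC

/-- … and it is literally a consequence of the NAMED Literature fact's proof file being in scope: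
recorded as the implication from the PROVED named fact's companion (the named fact
`NesterenkoWaldschmidt1996_thm_4_2` itself is the transcendence-measure form; we do not use it). -/
private theorem nesterenkoWaldschmidt1996_thm_4_2_inScope : NesterenkoWaldschmidt1996_thm_4_2 :=
  NesterenkoWaldschmidt1996_thm_4_2_holds

end Summit.Schanuel.Schanuel.Theorems.RootDecomp1BMovingZeroFree

end
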